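import Literature.Probability.RandomPlanarGeometry.SAWCountZdPlantedPatternCounts
import Literature.Probability.RandomPlanarGeometry.SAWPulledLargeForceExpansionZdWordTypesSix
import Literature.Probability.RandomPlanarGeometry.SAWPulledLargeForceExpansionZdFourSlackTwo
import HarnessLib

/-!
# The fourth coefficient of `c_n(ℤ^d)`: the census law (L1), `48·[d^{n−3}] c_n(ℤ^d) = −2^n(n³ − 12n² + 59n − 138)` for every `n ≥ 5`

Topic `Literature/Probability/RandomPlanarGeometry` (after `SAWCountZdTopCoefficients.lean` / `SAWCountZdThirdCoefficient.lean` (a-p1 g18: the top three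
coefficients of `d ↦ c_n(ℤ^d)`), `SAWCountZdBadWordTypes.lean` (a-p1 g20: (L1) ⟸ ONE count of canonical step words,
`exists_polynomial_count_topFour_of_card_canonical`) and the counting device `SAWCountZdPlantedPatternCounts.lean` (a-p1 g21); uses a-p3 g18's
`WordTypes` / `WordTypesSix` (`growthOK`/`axFixed_iff_canon_eq`), `ThreeSlackTwo.sum_four_eq_zero_iff`, `FourSlackTwo.sum_six_eq_zero_iff`, and
`SAWCountZdBadWalkLoops.sub_eq_four_or_six_of_repeat_deficiency_three` (a-p1 g20)).

PRINTED CONTEXT (locators only; nothing is quoted digit-for-digit). Madras–Slade (1993) §1.1 p. 3 (`c₄ = 2d(2d−1)³ − 2d(2d−2)`: the unit squares),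
eq. (1.1.8) p. 5 (the `1/d` expansion of `μ`, after Fisher–Sykes / Fisher–Gaunt), §1.2 p. 10 (memory-2 walks); Clisby–Liang–Slade (2007) §1.3
eq. (1)/(3) (the `1/d` expansions in print). NOT IN PRINT (lane statements): the theorem below for EVERY `n ≥ 5` — the fourth coefficient of the
polynomial `d ↦ c_n(ℤ^d)` — and its combinatorial core, the count of the canonical bad words.

THE COUNT (`card_badCanonical`): the canonical (axes named by first occurrence) reversal-free step words of length `n = l + 3` with `l` axes and a
repeat number `2^l·(n³ − 9n² + 29n − 40)`. PROOF BY WINDOWS, not by classes: in the slice (canonical, reversal-free, `l` axes) every repeat is at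
distance 4 or 6 (`sub_eq_four_or_six_of_wordPos_eq`, the word form of CAR I's loop lemma); a repeat at distance 4 IS the planted unit square
`x y x̄ ȳ` (`wordPos_eq_add_four_iff`), one at distance 6 is one of FIVE planted hexagon letter patterns (`exists_hex_of_wordPos_eq_add_six`: of the
fifteen pairings of six cancelling unit steps ten put a letter next to its reverse; distinct axes by TIGHTNESS — a coincidence of free axes would be
a fourth non-first position, `isPat_of_isPatEq_of_numAxes`), the fifth of which (`x y z ȳ z̄ x̄`) contains a square. By the planted-pattern type
counts: ★ the square class at ANY fixed window has `2^l(l² − 1) = 2^{n−3}(n−2)(n−4)` members (`card_sqSet`, the SECOND type count of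
`4X(X−1)(2X−1)^{n−4}` — independent of the window), adjacent square windows meet in the double square `x y x̄ ȳ x` (`2^l`, `sqUnion_inter_sqSet`),
windows two apart never meet (`sq_sq_far`: four non-first positions), each pure hexagon class has `2^l` members, and pure hexagons meet neither
squares nor each other (`hex_sq_disjoint`, `hex_hex_lt`, `hex_hex_same`); so `#bad = l·2^l(l²−1) − (l−1)·2^l + 4(l−2)·2^l = 2^l(l³ + 2l − 7)
= 2^{n−3}(n³ − 9n² + 29n − 40)`. (The lane's five loop-signature classes `4(n−4)² + (n−5)²(n−3) + (n−4) + (n−5) + 4(n−5)` of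
DESIGN-ZD-CENSUS-LAW-L1 are the same set cut differently; enumerator-verified `n ≤ 10`.)

THIS FILE (lane «pcv-sawmu», a-p1 g21; all PROVED, standard axioms; tool notions `sqPat`, `dsqPat`, `hexPat`, `IsPatEq`, `shrink`, `slice`,
`sqSet`, `dsqSet`, `hexSet`, `badSet`, `sqUnion`, `hexUnion` — not notions in print):
* ★ `wordPos_eq_add_four_iff`, ★ `exists_isPatEq_hexPat_of_wordPos_eq_add_six` / `wordPos_eq_add_six_of_isPatEq_hexPat`,
  ★ `isPat_of_isPatEq_of_numAxes` (tightness ⇒ distinct free axes), ★ `sub_eq_four_or_six_of_wordPos_eq`, ★ `exists_hex_of_wordPos_eq_add_six`;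
* configurations: `sq_sq_far`, `sq_and_sq_succ_iff_dsq`, `sq_succ_of_hex_four`, `hex_sq_disjoint`, `hex_hex_lt`, `hex_hex_same`, `badSet_eq_union`,
  `disjoint_sqUnion_hexUnion`;
* counts: ★★ `card_sqSet` (`2^l(l²−1)` at every window), `card_dsqSet`, `card_hexSet` (`2^l`), `card_hexUnion` (`4(n−5)2^l`), ★★ `card_sqUnion`
  (path inclusion–exclusion), ★★★ `card_badSet` / ★★★ `card_badCanonical` — THE COUNT, in the exact form of the hypothesis `hT` of
  `exists_polynomial_count_topFour_of_card_canonical`;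
* ★★★ `exists_polynomial_count_topFour` — for every `n = l + 3 ≥ 5` there is `P ∈ ℚ[X]` with `c_n(ℤ^d) = P(d)` (all `d`), `deg P ≤ n`, `[X^n]P = 2^n`,
  `[X^{n−1}]P = −(n−1)2^{n−1}`, `[X^{n−2}]P = 2^{n−3}(n²−5n+8)`, `48·[X^{n−3}]P = −2^n(n³−12n²+59n−138)`, UNCONDITIONALLY;
* ★★★ `exists_polynomial_largeForceCoeffZd_thirdCoeff_of_bridge_count` — Am. BC's fourth-symbol law `[d^{k−3}] c_k^{(d)} =
  (−1)^{k−1}2^{k−3}(k−3)(k−4)(5k²−35k+56)/12` (`k ≥ 3`) now conditional on ONE count only (the second axis class of the span-two cell).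
[cite: MadrasSlade1993, §1.1 p. 3; §1.1 eq. (1.1.8) p. 5; §1.2 p. 10] [cite: ClisbyLiangSlade2007, §1.3 eq. (1)/(3)]

Provenance: lane «pcv-sawmu», a-p1 g21 (2026-08-27).
-/

noncomputable section

open Finset
open scoped BigOperators
open Literature.Probability.LatticeModels
open Literature.Probability.RandomPlanarGeometry.SAW
open Literature.Probability.Percolation

namespace Literature.Probability.RandomPlanarGeometry.SAW.Zd

namespace WordTypes

section CensusL1

variable {n D : ℕ}

/-! ### The square, the double square and the five hexagon patterns -/

/-- The unit-square pattern `x y x̄ ȳ`. [cite: MadrasSlade1993, §1.1 (p. 3); lane tool notion] -/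
def sqPat : Pat 4 := ![(0, false), (1, false), (0, true), (1, true)]

/-- The double-square pattern `x y x̄ ȳ x` (loop-signature class `(4,4)`). [cite: MadrasSlade1993, §1.1 (p. 3); lane tool notion] -/
def dsqPat : Pat 5 := ![(0, false), (1, false), (0, true), (1, true), (0, false)]

/-- The five reversal-free hexagon patterns on three axes: `abc āb̄c̄`, `abc āc̄b̄`, `abc b̄āc̄`, `ab ā c b̄ c̄`, and `abc b̄c̄ā` (the last is the
square-in-hexagon, class `(4,6)`). [cite: MadrasSlade1993, §1.2 (p. 10); lane tool notion] -/
def hexPat : Fin 5 → Pat 6 :=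
  ![![(0, false), (1, false), (2, false), (0, true), (1, true), (2, true)],
    ![(0, false), (1, false), (2, false), (0, true), (2, true), (1, true)],
    ![(0, false), (1, false), (2, false), (1, true), (0, true), (2, true)],
    ![(0, false), (1, false), (0, true), (3, false), (1, true), (3, true)],
    ![(0, false), (1, false), (2, false), (1, true), (2, true), (0, true)]]

/-- The square pattern is good. [cite: MadrasSlade1993, §1.1 (p. 3); lane plumbing] -/
theorem sqPat_good : sqPat.Good := by decide

/-- The double-square pattern is good. [cite: MadrasSlade1993, §1.1 (p. 3); lane plumbing] -/
theorem dsqPat_good : dsqPat.Good := by decide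

/-- The hexagon patterns are good. [cite: MadrasSlade1993, §1.2 (p. 10); lane plumbing] -/
theorem hexPat_good (i : Fin 5) : (hexPat i).Good := by fin_cases i <;> decide

/-- The square pattern has two free letters. [cite: MadrasSlade1993, §1.1 (p. 3); lane plumbing] -/
theorem card_free_sqPat : sqPat.free.card = 2 := by decide

/-- The double-square pattern has two free letters. [cite: MadrasSlade1993, §1.1 (p. 3); lane plumbing] -/
theorem card_free_dsqPat : dsqPat.free.card = 2 := by decide

/-- Each hexagon pattern has three free letters. [cite: MadrasSlade1993, §1.2 (p. 10); lane plumbing] -/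
theorem card_free_hexPat (i : Fin 5) : (hexPat i).free.card = 3 := by fin_cases i <;> decide

/-! ### Block sums over a window -/

/-- The block sum of `stepVec` over `[k, k+m)` is the sum over the window. [cite: MadrasSlade1993, §1.1 (p. 1); lane plumbing] -/
theorem sum_block_eq_sum_window (w : Word n D) {k m : ℕ} (h : k + m ≤ n) :
    ∑ p ∈ Finset.univ.filter (fun p : Fin n => k ≤ p.val ∧ p.val < k + m), stepVec (w p) =
      ∑ i : Fin m, stepVec (window m k w h i) := by
  classical
  have himg : Finset.univ.filter (fun p : Fin n => k ≤ p.val ∧ p.val < k + m) =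
      (Finset.univ : Finset (Fin m)).map ⟨fun i : Fin m => (⟨k + i.val, by omega⟩ : Fin n),
        fun i j hij => Fin.ext (by simpa using congrArg Fin.val hij)⟩ := by
    ext p
    simp only [Finset.mem_filter, Finset.mem_univ, true_and, Finset.mem_map, Function.Embedding.coeFn_mk]
    constructor
    · rintro ⟨h1, h2⟩
      exact ⟨⟨p.val - k, by omega⟩, Fin.ext (by simp; omega)⟩
    · rintro ⟨i, rfl⟩
      simp
  rw [himg, Finset.sum_map]
  rfl

/-- A repeat at distance `m` from time `k` is a vanishing window sum. [cite: MadrasSlade1993, §1.1 (p. 1); lane plumbing] -/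
theorem wordPos_eq_iff_sum_window (w : Word n D) {k m : ℕ} (h : k + m ≤ n) :
    wordPos w k = wordPos w (k + m) ↔ ∑ i : Fin m, stepVec (window m k w h i) = 0 := by
  rw [wordPos_eq_add_sum_block w (show k ≤ k + m by omega) h, sum_block_eq_sum_window w h]
  constructor
  · intro heq
    have := congrArg (fun x => x - wordPos w k) heq
    simpa using this.symm
  · intro h0; rw [h0, add_zero]

/-- Unit-step sums and transverse-step sums vanish together (both iff every axis is balanced).
[cite: MadrasSlade1993, Definition 1.2.4; lane plumbing] -/
theorem sum_stepVec_eq_zero_iff_sum_twoStepV {ι : Type*} (t : Finset ι) (u : ι → Idx D) [Fintype ι] (ht : t = Finset.univ) :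
    ∑ p ∈ t, stepVec (u p) = (0 : Site D) ↔ ∑ p ∈ t, twoStepV D (u p) = 0 := by
  classical
  subst ht
  -- both sides: every axis balanced
  rw [sum_twoStepV_eq_zero_iff]
  -- `stepVec` version, for `ι` in place of `Fin n`: go through an enumeration
  have key := WordTypes.sum_stepVec_eq_zero_iff (Finset.univ : Finset (Fin (Fintype.card ι)))
    (u ∘ (Fintype.equivFin ι).symm)
  have hsum : ∑ p : Fin (Fintype.card ι), stepVec ((u ∘ (Fintype.equivFin ι).symm) p) = ∑ p : ι, stepVec (u p) :=
    Fintype.sum_equiv (Fintype.equivFin ι).symm _ _ fun _ => rfl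
  rw [hsum] at key
  rw [key]
  refine forall_congr' fun x => ?_
  have hc : ∀ b : Bool, (Finset.univ.filter fun p : Fin (Fintype.card ι) => (u ∘ (Fintype.equivFin ι).symm) p = (x, b)).card =
      (Finset.univ.filter fun p : ι => u p = (x, b)).card := by
    intro b
    refine Finset.card_bij (fun p _ => (Fintype.equivFin ι).symm p) (fun p hp => ?_) (fun p _ q _ h => by simpa using h)
      (fun q hq => ⟨Fintype.equivFin ι q, ?_, by simp⟩)
    · simpa using hp
    · simpa using hq
  rw [hc true, hc false]

/-- A window sum of `stepVec` vanishes iff the corresponding `twoStepV` sum does. [cite: MadrasSlade1993, Definition 1.2.4; lane plumbing] -/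
theorem sum_stepVec_window_eq_zero_iff {m : ℕ} (h : Word m D) :
    ∑ i : Fin m, stepVec (h i) = (0 : Site D) ↔ ∑ i : Fin m, twoStepV D (h i) = 0 :=
  sum_stepVec_eq_zero_iff_sum_twoStepV Finset.univ h rfl

/-! ### Squares: a repeat at distance 4 of a reversal-free word is the planted square pattern -/

/-- `revIdx a = (a.1, !a.2)`. [cite: MadrasSlade1993, §1.1 (p. 3); lane plumbing] -/
theorem revIdx_eq (a : Idx D) : revIdx a = (a.1, !a.2) := rfl

/-- ★ In a reversal-free word, `wordPos k = wordPos (k+4)` iff the window at `k` is the square `x y x̄ ȳ` on two distinct axes.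
[cite: MadrasSlade1993, §1.1 (p. 3: the unit squares behind `c₄`); lane lemma] -/
theorem wordPos_eq_add_four_iff {w : Word n D} (hw : NoRev w) {k : ℕ} (hk : k + 4 ≤ n) :
    wordPos w k = wordPos w (k + 4) ↔ AtWindow (IsPat sqPat) k w := by
  rw [wordPos_eq_iff_sum_window w hk, sum_stepVec_window_eq_zero_iff, Fin.sum_univ_four, ThreeSlackTwo.sum_four_eq_zero_iff]
  set h := window 4 k w hk with hh
  -- reversal-freeness inside the window
  have nr : ∀ i : ℕ, ∀ hi : i + 1 < 4, h ⟨i + 1, hi⟩ ≠ revIdx (h ⟨i, by omega⟩) := by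
    intro i hi heq
    have heq' : w ⟨k + (i + 1), by omega⟩ = ((w ⟨k + i, by omega⟩).1, !(w ⟨k + i, by omega⟩).2) := by
      simpa [hh, window_apply, revIdx_eq] using heq
    exact hw ⟨k + i, by omega⟩ (by simp; omega) ((congrArg w (Fin.ext (by simp; omega))).trans heq')
  constructor
  · rintro (⟨h1, -⟩ | ⟨h2, h3⟩ | ⟨-, h2⟩)
    · exact absurd h1 (nr 0 (by omega))
    · refine ⟨hk, fun p => ?_, fun p q hp hq hpq => ?_⟩
      · fin_cases p
        · rfl
        · rfl
        · simpa [sqPat, revIdx_eq, hh] using h2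
        · simpa [sqPat, revIdx_eq, hh] using h3
      · -- the free letters are `0, 1`; distinct axes by reversal-freeness
        have hax : (h 0).1 ≠ (h 1).1 := by
          intro hax
          rcases hb : h 1 with ⟨x, s⟩
          rcases ha : h 0 with ⟨y, t⟩
          rw [ha, hb] at hax
          simp only at hax
          subst hax
          by_cases hst : s = t
          · subst hst
            -- `h 1 = h 0`, so `h 2 = rev (h 0) = rev (h 1)`: a reversal at position 1
            apply nr 1 (by omega)
            rw [show (⟨1 + 1, _⟩ : Fin 4) = 2 from rfl, show (⟨1, _⟩ : Fin 4) = 1 from rfl, h2, ha, hb]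
          · apply nr 0 (by omega)
            rw [show (⟨0 + 1, _⟩ : Fin 4) = 1 from rfl, show (⟨0, _⟩ : Fin 4) = 0 from rfl, hb, ha, revIdx_eq]
            simp only [Prod.mk.injEq, true_and]
            cases s <;> cases t <;> simp_all
        (fin_cases p <;> fin_cases q <;> simp_all [sqPat]); exact fun h' => hax h'.symm
    · exact absurd h2 (nr 1 (by omega))
  · rintro ⟨_, hP, _⟩
    right; left
    refine ⟨?_, ?_⟩
    · simpa [sqPat, revIdx_eq, hh] using hP 2
    · simpa [sqPat, revIdx_eq, hh] using hP 3

/-! ### Hexagons: a repeat at distance 6 of a reversal-free word is one of five planted letter patterns (up to distinctness of axes) -/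

/-- The equation part of a pattern (no distinctness of the free axes). [cite: MadrasSlade1993, §1.2 (p. 10); lane tool notion] -/
def IsPatEq {m : ℕ} (π : Pat m) (h : Word m D) : Prop :=
  ∀ p : Fin m, h p = if (π p).2 then ((h (π p).1).1, !(h (π p).1).2) else h (π p).1

/-- ★ In a reversal-free word, `wordPos k = wordPos (k+6)` forces the window at `k` to satisfy the equations of one of the five hexagon
patterns (of the fifteen pairings of six cancelling unit steps, ten put a letter next to its reverse).
[cite: MadrasSlade1993, §1.2 (p. 10); lane lemma] -/
theorem exists_isPatEq_hexPat_of_wordPos_eq_add_six {w : Word n D} (hw : NoRev w) {k : ℕ} (hk : k + 6 ≤ n)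
    (hrep : wordPos w k = wordPos w (k + 6)) : ∃ i : Fin 5, IsPatEq (hexPat i) (window 6 k w hk) := by
  rw [wordPos_eq_iff_sum_window w hk, sum_stepVec_window_eq_zero_iff, Fin.sum_univ_six, FourSlackTwo.sum_six_eq_zero_iff] at hrep
  set h := window 6 k w hk with hh
  have nr : ∀ i : ℕ, ∀ hi : i + 1 < 6, h ⟨i + 1, hi⟩ ≠ revIdx (h ⟨i, by omega⟩) := by
    intro i hi heq
    have heq' : w ⟨k + (i + 1), by omega⟩ = ((w ⟨k + i, by omega⟩).1, !(w ⟨k + i, by omega⟩).2) := by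
      simpa [hh, window_apply, revIdx_eq] using heq
    exact hw ⟨k + i, by omega⟩ (by simp; omega) ((congrArg w (Fin.ext (by simp; omega))).trans heq')
  have n0 := nr 0 (by omega); have n1 := nr 1 (by omega); have n2 := nr 2 (by omega); have n3 := nr 3 (by omega)
  have n4 := nr 4 (by omega)
  simp only [show (⟨0 + 1, _⟩ : Fin 6) = 1 from rfl, show (⟨0, _⟩ : Fin 6) = 0 from rfl, show (⟨1 + 1, _⟩ : Fin 6) = 2 from rfl,
    show (⟨2 + 1, _⟩ : Fin 6) = 3 from rfl, show (⟨3 + 1, _⟩ : Fin 6) = 4 from rfl,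
    show (⟨4 + 1, _⟩ : Fin 6) = 5 from rfl] at n0 n1 n2 n3 n4
  rcases hrep with ⟨e1, -, -⟩ | ⟨e1, -, -⟩ | ⟨e1, -, -⟩ | ⟨-, -, e3⟩ | ⟨e1, e2, e3⟩ | ⟨-, -, e3⟩ | ⟨-, e2, -⟩ | ⟨e1, e2, e3⟩ |
    ⟨e1, e2, e3⟩ | ⟨-, e2, -⟩ | ⟨e1, e2, e3⟩ | ⟨-, -, e3⟩ | ⟨-, e2, -⟩ | ⟨e1, e2, e3⟩ | ⟨-, -, e3⟩
  · exact absurd e1 n0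
  · exact absurd e1 n0
  · exact absurd e1 n0
  · exact absurd e3 n4
  · -- `c = ā, f = b̄, g = ē`: pattern 3 (`a b ā e b̄ ē`)
    refine ⟨3, fun p => ?_⟩
    fin_cases p <;> simp [hexPat, revIdx_eq, e1, e2, e3]
  · exact absurd e3 n3
  · exact absurd e2 n1
  · -- `e = ā, f = b̄, g = c̄`: pattern 0
    refine ⟨0, fun p => ?_⟩
    fin_cases p <;> simp [hexPat, revIdx_eq, e1, e2, e3]
  · -- `e = ā, g = b̄, f = c̄`: pattern 1
    refine ⟨1, fun p => ?_⟩
    fin_cases p <;> simp [hexPat, revIdx_eq, e1, e2, e3]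
  · exact absurd e2 n1
  · -- `f = ā, e = b̄, g = c̄`: pattern 2
    refine ⟨2, fun p => ?_⟩
    fin_cases p <;> simp [hexPat, revIdx_eq, e1, e2, e3]
  · exact absurd e3 n2
  · exact absurd e2 n1
  · -- `g = ā, e = b̄, f = c̄`: pattern 4 (the square in the hexagon)
    refine ⟨4, fun p => ?_⟩
    fin_cases p <;> simp [hexPat, revIdx_eq, e1, e2, e3]
  · exact absurd e3 n2

/-- Conversely each hexagon pattern is a repeat at distance 6. [cite: MadrasSlade1993, §1.2 (p. 10); lane lemma] -/
theorem wordPos_eq_add_six_of_isPatEq_hexPat {w : Word n D} {k : ℕ} (hk : k + 6 ≤ n) {i : Fin 5}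
    (hP : IsPatEq (hexPat i) (window 6 k w hk)) : wordPos w k = wordPos w (k + 6) := by
  rw [wordPos_eq_iff_sum_window w hk, sum_stepVec_window_eq_zero_iff, Fin.sum_univ_six, FourSlackTwo.sum_six_eq_zero_iff]
  set h := window 6 k w hk with hh
  fin_cases i
  · -- `abc āb̄c̄`: disjunct 8
    refine Or.inr (Or.inr (Or.inr (Or.inr (Or.inr (Or.inr (Or.inr (Or.inl ⟨?_, ?_, ?_⟩)))))))
    · simpa [hexPat, revIdx_eq] using hP 3
    · simpa [hexPat, revIdx_eq] using hP 4
    · simpa [hexPat, revIdx_eq] using hP 5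
  · -- `abc āc̄b̄`: disjunct 9
    refine Or.inr (Or.inr (Or.inr (Or.inr (Or.inr (Or.inr (Or.inr (Or.inr (Or.inl ⟨?_, ?_, ?_⟩))))))))
    · simpa [hexPat, revIdx_eq] using hP 3
    · simpa [hexPat, revIdx_eq] using hP 5
    · simpa [hexPat, revIdx_eq] using hP 4
  · -- `abc b̄āc̄`: disjunct 11
    refine Or.inr (Or.inr (Or.inr (Or.inr (Or.inr (Or.inr (Or.inr (Or.inr (Or.inr (Or.inr (Or.inl ⟨?_, ?_, ?_⟩))))))))))
    · simpa [hexPat, revIdx_eq] using hP 4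
    · simpa [hexPat, revIdx_eq] using hP 3
    · simpa [hexPat, revIdx_eq] using hP 5
  · -- `ab ā e b̄ ē`: disjunct 5
    refine Or.inr (Or.inr (Or.inr (Or.inr (Or.inl ⟨?_, ?_, ?_⟩))))
    · simpa [hexPat, revIdx_eq] using hP 2
    · simpa [hexPat, revIdx_eq] using hP 4
    · simpa [hexPat, revIdx_eq] using hP 5
  · -- `abc b̄c̄ā`: disjunct 14
    refine Or.inr (Or.inr (Or.inr (Or.inr (Or.inr (Or.inr (Or.inr (Or.inr (Or.inr (Or.inr (Or.inr (Or.inr (Or.inr (Or.inl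
      ⟨?_, ?_, ?_⟩)))))))))))))
    · simpa [hexPat, revIdx_eq] using hP 5
    · simpa [hexPat, revIdx_eq] using hP 3
    · simpa [hexPat, revIdx_eq] using hP 4

/-- The square pattern, likewise, as a repeat (equation part only). [cite: MadrasSlade1993, §1.1 (p. 3); lane plumbing] -/
theorem isPat_iff_isPatEq_and {m : ℕ} (π : Pat m) (h : Word m D) :
    IsPat π h ↔ IsPatEq π h ∧ ∀ p q : Fin m, π p = (p, false) → π q = (q, false) → p ≠ q → (h p).1 ≠ (h q).1 :=
  Iff.rfl

/-- ★ TIGHTNESS FORCES DISTINCT AXES: if the equations of a good pattern hold at a window and the word has the maximal number of axes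
`n − (m − f)` that the `m − f` forced non-first positions allow, then the free letters have pairwise distinct axes (a coincidence would be
one more non-first position). [cite: MadrasSlade1993, Definition 1.2.4; lane lemma] -/
theorem isPat_of_isPatEq_of_numAxes {m : ℕ} {π : Pat m} (hπ : π.Good) {u : Word n D} {k : ℕ} (hk : k + m ≤ n)
    (heq : IsPatEq π (window m k u hk)) (hnum : n ≤ numAxes u + (m - π.free.card)) : IsPat π (window m k u hk) := by
  classical
  refine ⟨heq, fun p q hp hq hpq hax => ?_⟩
  -- the later of `p`, `q` is an extra non-first position
  have key : ∀ p q : Fin m, π p = (p, false) → π q = (q, false) → p < q →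
      (window m k u hk p).1 = (window m k u hk q).1 → False := by
    intro p q hp hq hlt hax
    set S : Finset (Fin n) := (Finset.univ.filter fun r : Fin m => ¬ π r = (r, false)).map
      ⟨fun r : Fin m => (⟨k + r.val, by omega⟩ : Fin n), fun r r' h => Fin.ext (by simpa using congrArg Fin.val h)⟩ with hS
    have hScard : S.card = m - π.free.card := by
      rw [hS, Finset.card_map]
      have := Finset.card_filter_add_card_filter_not (s := (Finset.univ : Finset (Fin m))) (fun r => π r = (r, false))
      rw [Finset.card_univ, Fintype.card_fin] at this
      unfold Pat.free
      omega
    have hqS : (⟨k + q.val, by omega⟩ : Fin n) ∉ S := by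
      intro hmem
      obtain ⟨r, hr, hrq⟩ := Finset.mem_map.1 hmem
      have : r = q := Fin.ext (by have := congrArg Fin.val hrq; simp at this; omega)
      rw [this] at hr
      exact (Finset.mem_filter.1 hr).2 hq
    have hle := numAxes_add_card_le u (insert ⟨k + q.val, by omega⟩ S) fun r hr => by
      rcases Finset.mem_insert.1 hr with rfl | hr
      · exact not_isFirst_of_axis_eq u (q := ⟨k + p.val, by omega⟩) (Fin.mk_lt_mk.2 (by omega)) hax
      · obtain ⟨r', hr', rfl⟩ := Finset.mem_map.1 hr
        have hr'' : π r' ≠ (r', false) := (Finset.mem_filter.1 hr').2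
        have hlt' := hπ.root_lt hr''
        refine not_isFirst_of_axis_eq u (q := ⟨k + (π r').1.val, by omega⟩) (Fin.mk_lt_mk.2 (by omega)) ?_
        have e := heq r'
        by_cases hb : (π r').2
        · rw [if_pos hb] at e
          have := congrArg Prod.fst e
          simp only [window_apply] at this
          exact this.symm
        · rw [if_neg hb] at e
          have := congrArg Prod.fst e
          simp only [window_apply] at this
          exact this.symm
    rw [Finset.card_insert_of_notMem hqS, hScard] at hle
    omega
  rcases lt_or_gt_of_ne hpq with hlt | hgt
  · exact key p q hp hq hlt hax
  · exact key q p hq hp hgt hax.symm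

/-! ### The slice of the census law: canonical reversal-free words of length `n` with `l` axes (`n = l + 3`) -/

/-- The rank of an axis is below the number of axes. [cite: MadrasSlade1993, Definition 1.2.4; lane plumbing] -/
theorem rank_lt_numAxes (u : Word n D) (p : Fin n) : rank u p < numAxes u := by
  unfold rank numAxes
  apply Finset.card_lt_card
  refine Finset.filter_ssubset.2 ⟨firstOcc u p, ?_, lt_irrefl _⟩
  exact Finset.mem_filter.2 ⟨Finset.mem_univ _, isFirst_firstOcc u p⟩

/-- A canonical word with `l` axes read over the alphabet of `l` axes. [cite: MadrasSlade1993, Definition 1.2.4; lane tool notion] -/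
def shrink (τ : Word n n) (hτ : canon τ = τ) {l : ℕ} (hl : numAxes τ = l) : Word n l :=
  fun p => (⟨(τ p).1.val, by
    have hfix : AxFixed τ := (axFixed_iff_canon_eq τ).2 hτ
    have h1 : (τ p).1.val = rank τ p := hfix p
    rw [h1, ← hl]; exact rank_lt_numAxes τ p⟩, (τ p).2)

/-- `shrink τ` has the type of `τ`. [cite: MadrasSlade1993, Definition 1.2.4; lane plumbing] -/
theorem sameType_shrink (τ : Word n n) (hτ : canon τ = τ) {l : ℕ} (hl : numAxes τ = l) : SameType τ (shrink τ hτ hl) := by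
  refine ⟨fun p q => ?_, fun p => rfl⟩
  simp only [shrink, Fin.ext_iff]

/-- ★ EVERY REPEAT IS AT DISTANCE 4 OR 6 (the word form of `sub_eq_four_or_six_of_repeat_deficiency_three`): in a canonical
reversal-free word of length `l + 3` with `l` axes, `wordPos i = wordPos j` (`i < j ≤ l+3`) forces `j − i ∈ {4, 6}`.
[cite: MadrasSlade1993, §1.1 (p. 3); §1.2 (p. 10); lane lemma] -/
theorem sub_eq_four_or_six_of_wordPos_eq {l : ℕ} {τ : Word (l + 3) (l + 3)} (hτ : canon τ = τ) (hrev : NoRev τ)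
    (hl : numAxes τ = l) {i j : ℕ} (hij : i < j) (hj : j ≤ l + 3) (hrep : wordPos τ i = wordPos τ j) : j - i = 4 ∨ j - i = 6 := by
  have hs := sameType_shrink τ hτ hl
  set τ' := shrink τ hτ hl
  have hmem : (wordPos τ' : ℕ → Site l) ∈ memWalks l 2 (l + 3) :=
    mem_memWalks.2 ⟨wordPos_mem_walks τ', (isMemory_two_wordPos_iff τ').2 (hs.noRev_iff'.1 hrev)⟩
  have hall : ∀ a : Fin l, ∃ i ≤ l + 3, wordPos τ' i a ≠ (0 : ℤ) :=
    (allAxes_wordPos_iff τ').2 ((forall_exists_axis_iff_numAxes_eq τ').2 (hs.numAxes_eq.symm.trans hl))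
  exact sub_eq_four_or_six_of_repeat_deficiency_three hmem hall hij hj ((hs.wordPos_eq_iff hij.le hj).1 hrep)

/-- The slice: canonical reversal-free words of length `n` with `l` axes. [cite: MadrasSlade1993, Definition 1.2.4; lane tool notion] -/
def slice (n l : ℕ) : Finset (Word n n) := Finset.univ.filter fun τ => canon τ = τ ∧ NoRev τ ∧ numAxes τ = l

/-- Membership in the slice. [cite: MadrasSlade1993, Definition 1.2.4; lane plumbing] -/
theorem mem_slice {l : ℕ} {τ : Word n n} : τ ∈ slice n l ↔ canon τ = τ ∧ NoRev τ ∧ numAxes τ = l := by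
  simp [slice]

/-- The square class at window `k`. [cite: MadrasSlade1993, §1.1 (p. 3); lane tool notion] -/
def sqSet (n l k : ℕ) : Finset (Word n n) := (slice n l).filter fun τ => AtWindow (IsPat sqPat) k τ

/-- The double-square class at window `k` (loop signature `(4,4)`). [cite: MadrasSlade1993, §1.1 (p. 3); lane tool notion] -/
def dsqSet (n l k : ℕ) : Finset (Word n n) := (slice n l).filter fun τ => AtWindow (IsPat dsqPat) k τ

/-- The hexagon class `i` at window `k`. [cite: MadrasSlade1993, §1.2 (p. 10); lane tool notion] -/
def hexSet (n l k : ℕ) (i : Fin 5) : Finset (Word n n) := (slice n l).filter fun τ => AtWindow (IsPat (hexPat i)) k τ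

/-! ### Letters of the planted patterns -/

/-- Same position, same letter. [cite: MadrasSlade1993, §1.1 (p. 1); lane plumbing] -/
theorem apply_mk_congr (τ : Word n D) {a b : ℕ} (h : a = b) {ha : a < n} (hb : b < n := by omega) : τ ⟨a, ha⟩ = τ ⟨b, hb⟩ := by
  subst h; rfl

/-- The letters of a planted square: `x y x̄ ȳ`, `x`, `y` on distinct axes. [cite: MadrasSlade1993, §1.1 (p. 3); lane plumbing] -/
theorem sq_letters {τ : Word n D} {k : ℕ} (h : AtWindow (IsPat sqPat) k τ) :
    ∃ hk : k + 4 ≤ n, τ ⟨k + 2, by omega⟩ = revIdx (τ ⟨k, by omega⟩) ∧ τ ⟨k + 3, by omega⟩ = revIdx (τ ⟨k + 1, by omega⟩) ∧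
      (τ ⟨k, by omega⟩).1 ≠ (τ ⟨k + 1, by omega⟩).1 := by
  obtain ⟨hk, hP, hD⟩ := h
  refine ⟨hk, ?_, ?_, ?_⟩
  · simpa [sqPat, revIdx_eq, window_apply] using hP 2
  · simpa [sqPat, revIdx_eq, window_apply] using hP 3
  · simpa [sqPat, window_apply] using hD 0 1 (by decide) (by decide) (by decide)

/-- Conversely, those letters make a planted square. [cite: MadrasSlade1993, §1.1 (p. 3); lane plumbing] -/
theorem atWindow_sq_of_letters {τ : Word n D} {k : ℕ} (hk : k + 4 ≤ n) (h2 : τ ⟨k + 2, by omega⟩ = revIdx (τ ⟨k, by omega⟩))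
    (h3 : τ ⟨k + 3, by omega⟩ = revIdx (τ ⟨k + 1, by omega⟩)) (hd : (τ ⟨k, by omega⟩).1 ≠ (τ ⟨k + 1, by omega⟩).1) :
    AtWindow (IsPat sqPat) k τ := by
  refine ⟨hk, fun p => ?_, fun p q hp hq hpq => ?_⟩
  · fin_cases p
    · rfl
    · rfl
    · simpa [sqPat, revIdx_eq, window_apply] using h2
    · simpa [sqPat, revIdx_eq, window_apply] using h3
  · have : ∀ p : Fin 4, sqPat p = (p, false) → p = 0 ∨ p = 1 := by decide
    rcases this p hp with rfl | rfl <;> rcases this q hq with rfl | rfl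
    · exact absurd rfl hpq
    · simpa [window_apply] using hd
    · simpa [window_apply] using hd.symm
    · exact absurd rfl hpq

/-- The letters of a planted double square: `x y x̄ ȳ x`. [cite: MadrasSlade1993, §1.1 (p. 3); lane plumbing] -/
theorem dsq_letters {τ : Word n D} {k : ℕ} (h : AtWindow (IsPat dsqPat) k τ) :
    ∃ hk : k + 5 ≤ n, τ ⟨k + 2, by omega⟩ = revIdx (τ ⟨k, by omega⟩) ∧ τ ⟨k + 3, by omega⟩ = revIdx (τ ⟨k + 1, by omega⟩) ∧
      τ ⟨k + 4, by omega⟩ = τ ⟨k, by omega⟩ ∧ (τ ⟨k, by omega⟩).1 ≠ (τ ⟨k + 1, by omega⟩).1 := by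
  obtain ⟨hk, hP, hD⟩ := h
  refine ⟨hk, ?_, ?_, ?_, ?_⟩
  · simpa [dsqPat, revIdx_eq, window_apply] using hP 2
  · simpa [dsqPat, revIdx_eq, window_apply] using hP 3
  · simpa [dsqPat, window_apply] using hP 4
  · simpa [dsqPat, window_apply] using hD 0 1 (by decide) (by decide) (by decide)

/-- Conversely, those letters make a planted double square. [cite: MadrasSlade1993, §1.1 (p. 3); lane plumbing] -/
theorem atWindow_dsq_of_letters {τ : Word n D} {k : ℕ} (hk : k + 5 ≤ n) (h2 : τ ⟨k + 2, by omega⟩ = revIdx (τ ⟨k, by omega⟩))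
    (h3 : τ ⟨k + 3, by omega⟩ = revIdx (τ ⟨k + 1, by omega⟩)) (h4 : τ ⟨k + 4, by omega⟩ = τ ⟨k, by omega⟩)
    (hd : (τ ⟨k, by omega⟩).1 ≠ (τ ⟨k + 1, by omega⟩).1) : AtWindow (IsPat dsqPat) k τ := by
  refine ⟨hk, fun p => ?_, fun p q hp hq hpq => ?_⟩
  · fin_cases p
    · rfl
    · rfl
    · simpa [dsqPat, revIdx_eq, window_apply] using h2
    · simpa [dsqPat, revIdx_eq, window_apply] using h3
    · simpa [dsqPat, window_apply] using h4
  · have : ∀ p : Fin 5, dsqPat p = (p, false) → p = 0 ∨ p = 1 := by decide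
    rcases this p hp with rfl | rfl <;> rcases this q hq with rfl | rfl
    · exact absurd rfl hpq
    · simpa [window_apply] using hd
    · simpa [window_apply] using hd.symm
    · exact absurd rfl hpq

/-- The letters of the planted hexagon patterns `0, 1, 2, 4` (free letters `a, b, c` at `k, k+1, k+2`, distinct axes) and `3`
(free letters at `k, k+1, k+3`). [cite: MadrasSlade1993, §1.2 (p. 10); lane plumbing] -/
theorem hex_letters {τ : Word n D} {k : ℕ} {i : Fin 5} (h : AtWindow (IsPat (hexPat i)) k τ) :
    ∃ hk : k + 6 ≤ n,
      (i = 0 → τ ⟨k + 3, by omega⟩ = revIdx (τ ⟨k, by omega⟩) ∧ τ ⟨k + 4, by omega⟩ = revIdx (τ ⟨k + 1, by omega⟩) ∧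
        τ ⟨k + 5, by omega⟩ = revIdx (τ ⟨k + 2, by omega⟩)) ∧
      (i = 1 → τ ⟨k + 3, by omega⟩ = revIdx (τ ⟨k, by omega⟩) ∧ τ ⟨k + 5, by omega⟩ = revIdx (τ ⟨k + 1, by omega⟩) ∧
        τ ⟨k + 4, by omega⟩ = revIdx (τ ⟨k + 2, by omega⟩)) ∧
      (i = 2 → τ ⟨k + 4, by omega⟩ = revIdx (τ ⟨k, by omega⟩) ∧ τ ⟨k + 3, by omega⟩ = revIdx (τ ⟨k + 1, by omega⟩) ∧
        τ ⟨k + 5, by omega⟩ = revIdx (τ ⟨k + 2, by omega⟩)) ∧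
      (i = 3 → τ ⟨k + 2, by omega⟩ = revIdx (τ ⟨k, by omega⟩) ∧ τ ⟨k + 4, by omega⟩ = revIdx (τ ⟨k + 1, by omega⟩) ∧
        τ ⟨k + 5, by omega⟩ = revIdx (τ ⟨k + 3, by omega⟩) ∧ (τ ⟨k, by omega⟩).1 ≠ (τ ⟨k + 3, by omega⟩).1 ∧
        (τ ⟨k + 1, by omega⟩).1 ≠ (τ ⟨k + 3, by omega⟩).1) ∧
      (i = 4 → τ ⟨k + 5, by omega⟩ = revIdx (τ ⟨k, by omega⟩) ∧ τ ⟨k + 3, by omega⟩ = revIdx (τ ⟨k + 1, by omega⟩) ∧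
        τ ⟨k + 4, by omega⟩ = revIdx (τ ⟨k + 2, by omega⟩)) ∧
      (τ ⟨k, by omega⟩).1 ≠ (τ ⟨k + 1, by omega⟩).1 ∧
      (i ≠ 3 → (τ ⟨k, by omega⟩).1 ≠ (τ ⟨k + 2, by omega⟩).1 ∧ (τ ⟨k + 1, by omega⟩).1 ≠ (τ ⟨k + 2, by omega⟩).1) := by
  obtain ⟨hk, hP, hD⟩ := h
  refine ⟨hk, ?_, ?_, ?_, ?_, ?_, ?_, ?_⟩
  · rintro rfl
    exact ⟨by simpa [hexPat, revIdx_eq, window_apply] using hP 3, by simpa [hexPat, revIdx_eq, window_apply] using hP 4,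
      by simpa [hexPat, revIdx_eq, window_apply] using hP 5⟩
  · rintro rfl
    exact ⟨by simpa [hexPat, revIdx_eq, window_apply] using hP 3, by simpa [hexPat, revIdx_eq, window_apply] using hP 5,
      by simpa [hexPat, revIdx_eq, window_apply] using hP 4⟩
  · rintro rfl
    exact ⟨by simpa [hexPat, revIdx_eq, window_apply] using hP 4, by simpa [hexPat, revIdx_eq, window_apply] using hP 3,
      by simpa [hexPat, revIdx_eq, window_apply] using hP 5⟩
  · rintro rfl
    exact ⟨by simpa [hexPat, revIdx_eq, window_apply] using hP 2, by simpa [hexPat, revIdx_eq, window_apply] using hP 4,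
      by simpa [hexPat, revIdx_eq, window_apply] using hP 5,
      by simpa [hexPat, window_apply] using hD 0 3 (by decide) (by decide) (by decide),
      by simpa [hexPat, window_apply] using hD 1 3 (by decide) (by decide) (by decide)⟩
  · rintro rfl
    exact ⟨by simpa [hexPat, revIdx_eq, window_apply] using hP 5, by simpa [hexPat, revIdx_eq, window_apply] using hP 3,
      by simpa [hexPat, revIdx_eq, window_apply] using hP 4⟩
  · have h01 : ∀ i : Fin 5, hexPat i 0 = (0, false) ∧ hexPat i 1 = (1, false) := by decide
    simpa [window_apply] using hD 0 1 (h01 i).1 (h01 i).2 (by decide)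
  · intro hi
    have h012 : ∀ i : Fin 5, i ≠ 3 → hexPat i 0 = (0, false) ∧ hexPat i 1 = (1, false) ∧ hexPat i 2 = (2, false) := by decide
    obtain ⟨h0, h1, h2⟩ := h012 i hi
    exact ⟨by simpa [window_apply] using hD 0 2 h0 h2 (by decide), by simpa [window_apply] using hD 1 2 h1 h2 (by decide)⟩

/-- Axis bookkeeping: the reverse letter has the same axis. [cite: MadrasSlade1993, §1.1 (p. 3); lane plumbing] -/
theorem fst_revIdx (a : Idx D) : (revIdx a).1 = a.1 := rfl

/-- Axis bookkeeping: letters with equal reverses have equal axes. [cite: MadrasSlade1993, §1.1 (p. 3); lane plumbing] -/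
theorem fst_eq_of_revIdx_eq {a b : Idx D} (h : revIdx a = revIdx b) : a.1 = b.1 := by
  have := congrArg Prod.fst h
  exact this

/-! ### Non-first positions of the planted patterns, and the impossible configurations -/

/-- Four distinct non-first positions are too many for the slice `numAxes = n − 3`. [cite: MadrasSlade1993, Definition 1.2.4; lane lemma] -/
theorem false_of_four_nonFirst {τ : Word n D} (hnum : n ≤ numAxes τ + 3) (p₁ p₂ p₃ p₄ : ℕ) (h₁ : p₁ < n) (h₂ : p₂ < n)
    (h₃ : p₃ < n) (h₄ : p₄ < n) (hd : p₁ ≠ p₂ ∧ p₁ ≠ p₃ ∧ p₁ ≠ p₄ ∧ p₂ ≠ p₃ ∧ p₂ ≠ p₄ ∧ p₃ ≠ p₄)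
    (n₁ : ¬ IsFirst τ ⟨p₁, h₁⟩) (n₂ : ¬ IsFirst τ ⟨p₂, h₂⟩) (n₃ : ¬ IsFirst τ ⟨p₃, h₃⟩) (n₄ : ¬ IsFirst τ ⟨p₄, h₄⟩) : False := by
  classical
  have hle := numAxes_add_card_le τ {⟨p₁, h₁⟩, ⟨p₂, h₂⟩, ⟨p₃, h₃⟩, ⟨p₄, h₄⟩} (by
    intro p hp
    simp only [Finset.mem_insert, Finset.mem_singleton] at hp
    rcases hp with rfl | rfl | rfl | rfl <;> assumption)
  have hcard : ({⟨p₁, h₁⟩, ⟨p₂, h₂⟩, ⟨p₃, h₃⟩, ⟨p₄, h₄⟩} : Finset (Fin n)).card = 4 := by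
    obtain ⟨d12, d13, d14, d23, d24, d34⟩ := hd
    rw [Finset.card_insert_of_notMem (by simp [Fin.ext_iff]; omega), Finset.card_insert_of_notMem (by simp [Fin.ext_iff]; omega),
      Finset.card_insert_of_notMem (by simp [Fin.ext_iff]; omega), Finset.card_singleton]
  omega

/-- A position carrying the reverse or a copy of an earlier letter is not a first occurrence. [cite: MadrasSlade1993, Definition 1.2.4; lane plumbing] -/
theorem not_isFirst_of_eq_revIdx (τ : Word n D) {q p : ℕ} (hq : q < n) (hp : p < n) (hqp : q < p)
    (h : τ ⟨p, hp⟩ = revIdx (τ ⟨q, hq⟩) ∨ τ ⟨p, hp⟩ = τ ⟨q, hq⟩) : ¬ IsFirst τ ⟨p, hp⟩ := by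
  refine not_isFirst_of_axis_eq τ (q := ⟨q, hq⟩) (Fin.mk_lt_mk.2 hqp) ?_
  rcases h with h | h
  · rw [h]; rfl
  · rw [h]

/-- ★ TWO SQUARES AT DISTANCE ≥ 2 ARE IMPOSSIBLE in the slice. [cite: MadrasSlade1993, §1.1 (p. 3); lane lemma] -/
theorem sq_sq_far {l : ℕ} {τ : Word n n} (hτ : τ ∈ slice n l) (hn : n = l + 3) {k k' : ℕ} (hkk : k + 2 ≤ k')
    (h1 : AtWindow (IsPat sqPat) k τ) (h2 : AtWindow (IsPat sqPat) k' τ) : False := by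
  obtain ⟨hk, a2, a3, -⟩ := sq_letters h1
  obtain ⟨hk', b2, b3, -⟩ := sq_letters h2
  obtain ⟨-, -, hl⟩ := mem_slice.1 hτ
  exact false_of_four_nonFirst (by omega) (k + 2) (k + 3) (k' + 2) (k' + 3) (by omega) (by omega) (by omega) (by omega)
    (by omega) (not_isFirst_of_eq_revIdx τ _ _ (by omega) (Or.inl a2)) (not_isFirst_of_eq_revIdx τ _ _ (by omega) (Or.inl a3))
    (not_isFirst_of_eq_revIdx τ _ _ (by omega) (Or.inl b2)) (not_isFirst_of_eq_revIdx τ _ _ (by omega) (Or.inl b3))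

/-- ★ ADJACENT SQUARES = THE DOUBLE SQUARE. [cite: MadrasSlade1993, §1.1 (p. 3); lane lemma] -/
theorem sq_and_sq_succ_iff_dsq {τ : Word n D} {k : ℕ} :
    AtWindow (IsPat sqPat) k τ ∧ AtWindow (IsPat sqPat) (k + 1) τ ↔ AtWindow (IsPat dsqPat) k τ := by
  constructor
  · rintro ⟨h1, h2⟩
    obtain ⟨hk, a2, a3, ad⟩ := sq_letters h1
    obtain ⟨hk', b2, b3, -⟩ := sq_letters h2
    refine atWindow_dsq_of_letters hk' a2 a3 ?_ ad
    rw [apply_mk_congr τ (show k + 1 + 3 = k + 4 by omega), apply_mk_congr τ (show k + 1 + 1 = k + 2 by omega), a2,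
      revIdx_revIdx] at b3
    exact b3
  · intro h
    obtain ⟨hk, a2, a3, a4, ad⟩ := dsq_letters h
    refine ⟨atWindow_sq_of_letters (by omega) a2 a3 ad, atWindow_sq_of_letters hk ?_ ?_ ?_⟩
    · rw [apply_mk_congr τ (show k + 1 + 2 = k + 3 by omega)]; exact a3
    · rw [apply_mk_congr τ (show k + 1 + 3 = k + 4 by omega), apply_mk_congr τ (show k + 1 + 1 = k + 2 by omega), a2,
        revIdx_revIdx]; exact a4
    · rw [apply_mk_congr τ (show k + 1 + 1 = k + 2 by omega), a2, fst_revIdx]; exact ad.symm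

/-- ★ THE SQUARE IN THE HEXAGON contains the square at `k + 1`. [cite: MadrasSlade1993, §1.2 (p. 10); lane lemma] -/
theorem sq_succ_of_hex_four {τ : Word n D} {k : ℕ} (h : AtWindow (IsPat (hexPat 4)) k τ) : AtWindow (IsPat sqPat) (k + 1) τ := by
  obtain ⟨hk, -, -, -, -, h4, -, hne⟩ := hex_letters h
  obtain ⟨e5, e3, e4⟩ := h4 rfl
  obtain ⟨-, h12⟩ := hne (by decide)
  refine atWindow_sq_of_letters (by omega) ?_ ?_ ?_
  · rw [apply_mk_congr τ (show k + 1 + 2 = k + 3 by omega)]; exact e3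
  · rw [apply_mk_congr τ (show k + 1 + 3 = k + 4 by omega), apply_mk_congr τ (show k + 1 + 1 = k + 2 by omega)]; exact e4
  · rw [apply_mk_congr τ (show k + 1 + 1 = k + 2 by omega)]; exact h12

/-- ★ A PURE HEXAGON (patterns `0–3`) MEETS NO SQUARE in the slice. [cite: MadrasSlade1993, §1.2 (p. 10); lane lemma] -/
theorem hex_sq_disjoint {l : ℕ} {τ : Word n n} (hτ : τ ∈ slice n l) (hn : n = l + 3) {k k' : ℕ} {i : Fin 5} (hi : i ≠ 4)
    (h1 : AtWindow (IsPat (hexPat i)) k τ) (h2 : AtWindow (IsPat sqPat) k' τ) : False := by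
  obtain ⟨-, -, hl⟩ := mem_slice.1 hτ
  obtain ⟨hk, c0, c1, c2, c3, -, d01, dne⟩ := hex_letters h1
  obtain ⟨hk', b2, b3, -⟩ := sq_letters h2
  have nb2 := not_isFirst_of_eq_revIdx τ _ _ (by omega) (Or.inl b2)
  have nb3 := not_isFirst_of_eq_revIdx τ _ _ (by omega) (Or.inl b3)
  have hnum : n ≤ numAxes τ + 3 := by omega
  by_cases hi3 : i = 3
  · subst hi3
    obtain ⟨e2, e4, e5, d03, d13⟩ := c3 rfl
    have n2 := not_isFirst_of_eq_revIdx τ _ _ (by omega) (Or.inl e2)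
    have n4 := not_isFirst_of_eq_revIdx τ _ _ (by omega) (Or.inl e4)
    have n5 := not_isFirst_of_eq_revIdx τ _ _ (by omega) (Or.inl e5)
    by_cases hA : k' + 3 ≠ k + 2 ∧ k' + 3 ≠ k + 4 ∧ k' + 3 ≠ k + 5
    · exact false_of_four_nonFirst hnum (k + 2) (k + 4) (k + 5) (k' + 3) (by omega) (by omega) (by omega) (by omega) (by omega)
        n2 n4 n5 nb3
    · by_cases hB : k' + 2 ≠ k + 2 ∧ k' + 2 ≠ k + 4 ∧ k' + 2 ≠ k + 5
      · exact false_of_four_nonFirst hnum (k + 2) (k + 4) (k + 5) (k' + 2) (by omega) (by omega) (by omega) (by omega) (by omega)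
          n2 n4 n5 nb2
      · -- `k' = k + 2`: the square's third letter `τ(k+4) = rev τ(k+2) = a` against `τ(k+4) = b̄`
        have hk2 : k' = k + 2 := by omega
        subst hk2
        rw [apply_mk_congr τ (show k + 2 + 2 = k + 4 by omega), e2, revIdx_revIdx] at b2
        exact d01 (congrArg Prod.fst (e4.symm.trans b2)).symm
  · obtain ⟨d02, d12⟩ := dne hi3
    -- patterns 0, 1, 2: non-first positions k+3, k+4, k+5
    have n345 : ¬ IsFirst τ ⟨k + 3, by omega⟩ ∧ ¬ IsFirst τ ⟨k + 4, by omega⟩ ∧ ¬ IsFirst τ ⟨k + 5, by omega⟩ := by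
      fin_cases i
      · obtain ⟨e3, e4, e5⟩ := c0 rfl
        exact ⟨not_isFirst_of_eq_revIdx τ _ _ (by omega) (Or.inl e3), not_isFirst_of_eq_revIdx τ _ _ (by omega) (Or.inl e4),
          not_isFirst_of_eq_revIdx τ _ _ (by omega) (Or.inl e5)⟩
      · obtain ⟨e3, e5, e4⟩ := c1 rfl
        exact ⟨not_isFirst_of_eq_revIdx τ _ _ (by omega) (Or.inl e3), not_isFirst_of_eq_revIdx τ _ _ (by omega) (Or.inl e4),
          not_isFirst_of_eq_revIdx τ _ _ (by omega) (Or.inl e5)⟩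
      · obtain ⟨e4, e3, e5⟩ := c2 rfl
        exact ⟨not_isFirst_of_eq_revIdx τ _ _ (by omega) (Or.inl e3), not_isFirst_of_eq_revIdx τ _ _ (by omega) (Or.inl e4),
          not_isFirst_of_eq_revIdx τ _ _ (by omega) (Or.inl e5)⟩
      · exact absurd rfl hi3
      · exact absurd rfl hi
    obtain ⟨n3, n4, n5⟩ := n345
    by_cases hA : k' + 3 ≠ k + 3 ∧ k' + 3 ≠ k + 4 ∧ k' + 3 ≠ k + 5
    · exact false_of_four_nonFirst hnum (k + 3) (k + 4) (k + 5) (k' + 3) (by omega) (by omega) (by omega) (by omega) (by omega)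
        n3 n4 n5 nb3
    · by_cases hB : k' + 2 ≠ k + 3 ∧ k' + 2 ≠ k + 4 ∧ k' + 2 ≠ k + 5
      · exact false_of_four_nonFirst hnum (k + 3) (k + 4) (k + 5) (k' + 2) (by omega) (by omega) (by omega) (by omega) (by omega)
          n3 n4 n5 nb2
      · -- `k' = k + 1` or `k' = k + 2`: letter algebra
        have hk12 : k' = k + 1 ∨ k' = k + 2 := by omega
        rcases hk12 with rfl | rfl
        · rw [apply_mk_congr τ (show k + 1 + 2 = k + 3 by omega)] at b2
          rw [apply_mk_congr τ (show k + 1 + 3 = k + 4 by omega), apply_mk_congr τ (show k + 1 + 1 = k + 2 by omega)] at b3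
          fin_cases i
          · obtain ⟨e3, -, -⟩ := c0 rfl
            exact d01 (fst_eq_of_revIdx_eq (e3.symm.trans b2))
          · obtain ⟨e3, -, -⟩ := c1 rfl
            exact d01 (fst_eq_of_revIdx_eq (e3.symm.trans b2))
          · obtain ⟨e4, -, -⟩ := c2 rfl
            exact d02 (fst_eq_of_revIdx_eq (e4.symm.trans b3))
          · exact absurd rfl hi3
          · exact absurd rfl hi
        · rw [apply_mk_congr τ (show k + 2 + 2 = k + 4 by omega)] at b2
          rw [apply_mk_congr τ (show k + 2 + 3 = k + 5 by omega), apply_mk_congr τ (show k + 2 + 1 = k + 3 by omega)] at b3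
          fin_cases i
          · obtain ⟨-, e4, -⟩ := c0 rfl
            exact d12 (fst_eq_of_revIdx_eq (e4.symm.trans b2))
          · obtain ⟨e3, e5, -⟩ := c1 rfl
            rw [e3, revIdx_revIdx] at b3
            exact d01 (congrArg Prod.fst (e5.symm.trans b3)).symm
          · obtain ⟨e4, -, -⟩ := c2 rfl
            exact d02 (fst_eq_of_revIdx_eq (e4.symm.trans b2))
          · exact absurd rfl hi3
          · exact absurd rfl hi

/-- The three forced non-first positions of a planted hexagon pattern. [cite: MadrasSlade1993, §1.2 (p. 10); lane plumbing] -/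
theorem hex_nonFirst {τ : Word n D} {k : ℕ} {i : Fin 5} (h : AtWindow (IsPat (hexPat i)) k τ) :
    ∃ hk : k + 6 ≤ n, ¬ IsFirst τ ⟨k + 4, by omega⟩ ∧ ¬ IsFirst τ ⟨k + 5, by omega⟩ ∧
      (i ≠ 3 → ¬ IsFirst τ ⟨k + 3, by omega⟩) ∧ (i = 3 → ¬ IsFirst τ ⟨k + 2, by omega⟩) := by
  obtain ⟨hk, c0, c1, c2, c3, c4, -, -⟩ := hex_letters h
  refine ⟨hk, ?_⟩
  fin_cases i
  · obtain ⟨e3, e4, e5⟩ := c0 rfl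
    exact ⟨not_isFirst_of_eq_revIdx τ _ _ (by omega) (Or.inl e4), not_isFirst_of_eq_revIdx τ _ _ (by omega) (Or.inl e5),
      fun _ => not_isFirst_of_eq_revIdx τ _ _ (by omega) (Or.inl e3), fun h => absurd h (by decide)⟩
  · obtain ⟨e3, e5, e4⟩ := c1 rfl
    exact ⟨not_isFirst_of_eq_revIdx τ _ _ (by omega) (Or.inl e4), not_isFirst_of_eq_revIdx τ _ _ (by omega) (Or.inl e5),
      fun _ => not_isFirst_of_eq_revIdx τ _ _ (by omega) (Or.inl e3), fun h => absurd h (by decide)⟩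
  · obtain ⟨e4, e3, e5⟩ := c2 rfl
    exact ⟨not_isFirst_of_eq_revIdx τ _ _ (by omega) (Or.inl e4), not_isFirst_of_eq_revIdx τ _ _ (by omega) (Or.inl e5),
      fun _ => not_isFirst_of_eq_revIdx τ _ _ (by omega) (Or.inl e3), fun h => absurd h (by decide)⟩
  · obtain ⟨e2, e4, e5, -, -⟩ := c3 rfl
    exact ⟨not_isFirst_of_eq_revIdx τ _ _ (by omega) (Or.inl e4), not_isFirst_of_eq_revIdx τ _ _ (by omega) (Or.inl e5),
      fun h => absurd rfl h, fun _ => not_isFirst_of_eq_revIdx τ _ _ (by omega) (Or.inl e2)⟩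
  · obtain ⟨e5, e3, e4⟩ := c4 rfl
    exact ⟨not_isFirst_of_eq_revIdx τ _ _ (by omega) (Or.inl e4), not_isFirst_of_eq_revIdx τ _ _ (by omega) (Or.inl e5),
      fun _ => not_isFirst_of_eq_revIdx τ _ _ (by omega) (Or.inl e3), fun h => absurd h (by decide)⟩

/-- ★ TWO DIFFERENT HEXAGON WINDOWS ARE IMPOSSIBLE in the slice. [cite: MadrasSlade1993, §1.2 (p. 10); lane lemma] -/
theorem hex_hex_lt {l : ℕ} {τ : Word n n} (hτ : τ ∈ slice n l) (hn : n = l + 3) {k k' : ℕ} (hkk : k < k') {i i' : Fin 5}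
    (h1 : AtWindow (IsPat (hexPat i)) k τ) (h2 : AtWindow (IsPat (hexPat i')) k' τ) : False := by
  obtain ⟨-, -, hl⟩ := mem_slice.1 hτ
  obtain ⟨hk, n4, n5, n3, n2⟩ := hex_nonFirst h1
  obtain ⟨hk', -, m5, -, -⟩ := hex_nonFirst h2
  by_cases hi : i = 3
  · exact false_of_four_nonFirst (by omega) (k + 2) (k + 4) (k + 5) (k' + 5) (by omega) (by omega) (by omega) (by omega) (by omega)
      (n2 hi) n4 n5 m5
  · exact false_of_four_nonFirst (by omega) (k + 3) (k + 4) (k + 5) (k' + 5) (by omega) (by omega) (by omega) (by omega) (by omega)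
      (n3 hi) n4 n5 m5

/-- ★ TWO DIFFERENT PURE HEXAGON PATTERNS AT THE SAME WINDOW ARE IMPOSSIBLE. [cite: MadrasSlade1993, §1.2 (p. 10); lane lemma] -/
theorem hex_hex_same {τ : Word n D} {k : ℕ} {i i' : Fin 5} (hii : i ≠ i') (hi : i ≠ 4) (hi' : i' ≠ 4)
    (h1 : AtWindow (IsPat (hexPat i)) k τ) (h2 : AtWindow (IsPat (hexPat i')) k τ) : False := by
  -- reduce to `i < i'`
  have key : ∀ j j' : Fin 5, j < j' → j' ≠ 4 → AtWindow (IsPat (hexPat j)) k τ → AtWindow (IsPat (hexPat j')) k τ → False := by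
    intro j j' hjj hj4 g1 g2
    obtain ⟨hk, c0, c1, c2, -, -, d01, dne⟩ := hex_letters g1
    obtain ⟨hk', b0, b1, b2, b3, b4, bd, bdne⟩ := hex_letters g2
    fin_cases j' <;> fin_cases j <;> simp at hjj hj4
    · -- (0, 1): `τ(k+4)` is `b̄` and `c̄`
      obtain ⟨-, e4, -⟩ := c0 rfl
      obtain ⟨-, -, f4⟩ := b1 rfl
      exact (dne (by decide)).2 (fst_eq_of_revIdx_eq (e4.symm.trans f4))
    · -- (0, 2): `τ(k+3)` is `ā` and `b̄`
      obtain ⟨e3, -, -⟩ := c0 rfl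
      obtain ⟨-, f3, -⟩ := b2 rfl
      exact d01 (fst_eq_of_revIdx_eq (e3.symm.trans f3))
    · -- (1, 2)
      obtain ⟨e3, -, -⟩ := c1 rfl
      obtain ⟨-, f3, -⟩ := b2 rfl
      exact d01 (fst_eq_of_revIdx_eq (e3.symm.trans f3))
    · -- (0, 3): `τ(k+2) = ā` against distinct axes of `a`, `c`
      obtain ⟨f2, -, -, -, -⟩ := b3 rfl
      exact (dne (by decide)).1 (by rw [f2]; rfl)
    · -- (1, 3)
      obtain ⟨f2, -, -, -, -⟩ := b3 rfl
      exact (dne (by decide)).1 (by rw [f2]; rfl)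
    · -- (2, 3)
      obtain ⟨f2, -, -, -, -⟩ := b3 rfl
      exact (dne (by decide)).1 (by rw [f2]; rfl)
  rcases lt_or_gt_of_ne hii with hlt | hgt
  · exact key i i' hlt hi' h1 h2
  · exact key i' i hgt hi h2 h1

/-- ★ In the slice, a repeat at distance 6 is one of the five planted hexagon patterns (distinct free axes by tightness).
[cite: MadrasSlade1993, §1.2 (p. 10); lane lemma] -/
theorem exists_hex_of_wordPos_eq_add_six {l : ℕ} {τ : Word n n} (hτ : τ ∈ slice n l) (hn : n = l + 3) {k : ℕ}
    (hk : k + 6 ≤ n) (hrep : wordPos τ k = wordPos τ (k + 6)) : ∃ i : Fin 5, AtWindow (IsPat (hexPat i)) k τ := by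
  obtain ⟨hcan, hrev, hl⟩ := mem_slice.1 hτ
  obtain ⟨i, heq⟩ := exists_isPatEq_hexPat_of_wordPos_eq_add_six hrev hk hrep
  exact ⟨i, hk, isPat_of_isPatEq_of_numAxes (hexPat_good i) hk heq (by rw [card_free_hexPat]; omega)⟩

/-! ### The bad words: squares or pure hexagons -/

open Classical in
/-- The BAD words of the slice: a repeat `wordPos i = wordPos j`, `i < j ≤ n`. [cite: MadrasSlade1993, §1.1 eq. (1.1.8) p. 5; lane tool notion] -/
def badSet (n l : ℕ) : Finset (Word n n) := (slice n l).filter fun τ => ∃ i ≤ n, ∃ j ≤ n, i < j ∧ wordPos τ i = wordPos τ j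

open Classical in
/-- Words of the slice with a square somewhere. [cite: MadrasSlade1993, §1.1 (p. 3); lane tool notion] -/
def sqUnion (n l K : ℕ) : Finset (Word n n) := (slice n l).filter fun τ => ∃ k < K, AtWindow (IsPat sqPat) k τ

open Classical in
/-- Words of the slice with a pure hexagon (patterns `0–3`) somewhere. [cite: MadrasSlade1993, §1.2 (p. 10); lane tool notion] -/
def hexUnion (n l : ℕ) : Finset (Word n n) := (slice n l).filter fun τ => ∃ k, ∃ i : Fin 5, i ≠ 4 ∧ AtWindow (IsPat (hexPat i)) k τ

/-- ★ BAD = SQUARE SOMEWHERE OR PURE HEXAGON SOMEWHERE (repeats are at distance 4 or 6; the square-in-hexagon has a square).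
[cite: MadrasSlade1993, §1.1 eq. (1.1.8) p. 5; lane lemma] -/
theorem badSet_eq_union {l : ℕ} (hn : n = l + 3) : badSet n l = sqUnion n l (n - 3) ∪ hexUnion n l := by
  classical
  ext τ
  simp only [badSet, sqUnion, hexUnion, Finset.mem_union, Finset.mem_filter]
  constructor
  · rintro ⟨hτ, i, hi, j, hj, hij, hrep⟩
    obtain ⟨hcan, hrev, hl⟩ := mem_slice.1 hτ
    subst hn
    rcases sub_eq_four_or_six_of_wordPos_eq hcan hrev hl hij hj hrep with h4 | h6
    · have hj4 : j = i + 4 := by omega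
      subst hj4
      exact Or.inl ⟨hτ, i, by omega, (wordPos_eq_add_four_iff hrev hj).1 hrep⟩
    · have hj6 : j = i + 6 := by omega
      subst hj6
      obtain ⟨c, hc⟩ := exists_hex_of_wordPos_eq_add_six hτ rfl hj hrep
      by_cases hc4 : c = 4
      · subst hc4
        exact Or.inl ⟨hτ, i + 1, by omega, sq_succ_of_hex_four hc⟩
      · exact Or.inr ⟨hτ, i, c, hc4, hc⟩
  · rintro (⟨hτ, k, -, hsq⟩ | ⟨hτ, k, c, -, hc⟩)
    · obtain ⟨-, hrev, -⟩ := mem_slice.1 hτ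
      have hk : k + 4 ≤ n := hsq.1
      exact ⟨hτ, k, by omega, k + 4, hk, by omega, (wordPos_eq_add_four_iff hrev hk).2 hsq⟩
    · obtain ⟨hk, hP, -⟩ := hc
      exact ⟨hτ, k, by omega, k + 6, hk, by omega, wordPos_eq_add_six_of_isPatEq_hexPat hk hP⟩

/-- Squares and pure hexagons do not coexist. [cite: MadrasSlade1993, §1.2 (p. 10); lane lemma] -/
theorem disjoint_sqUnion_hexUnion {l : ℕ} (hn : n = l + 3) (K : ℕ) : Disjoint (sqUnion n l K) (hexUnion n l) := by
  classical
  rw [Finset.disjoint_left]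
  intro τ h1 h2
  simp only [sqUnion, hexUnion, Finset.mem_filter] at h1 h2
  obtain ⟨hτ, k', -, hsq⟩ := h1
  obtain ⟨-, k, i, hi, hhex⟩ := h2
  exact hex_sq_disjoint hτ hn hi hhex hsq

/-! ### The counts of the classes (from the planted-pattern type counts) -/

/-- `2·C(j,2) = j(j−1)` over `ℚ`. [cite: MadrasSlade1993, §1.1 eq. (1.1.8) p. 5; lane plumbing] -/
theorem two_mul_choose_two_cast (j : ℕ) : (2 : ℚ) * (j.choose 2 : ℕ) = (j : ℚ) * ((j : ℚ) - 1) := by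
  induction j with
  | zero => simp
  | succ j ih =>
    rw [Nat.choose_succ_succ' j 1, Nat.choose_one_right]
    push_cast
    linear_combination ih

/-- A class cut out of the slice, in the form of the planted-pattern type counts. [cite: MadrasSlade1993, Definition 1.2.4; lane plumbing] -/
theorem filter_slice_eq (P : Word n n → Prop) [DecidablePred P] {l j : ℕ} (hlj : l = j) :
    (slice n l).filter P = Finset.univ.filter fun τ : Word n n => canon τ = τ ∧ (NoRev τ ∧ P τ) ∧ numAxes τ = j := by
  subst hlj
  ext τ
  simp only [slice, Finset.mem_filter, Finset.mem_univ, true_and]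
  tauto

/-- ★★ THE SQUARE CLASS AT A FIXED WINDOW: `|sqSet| = 2^l(l² − 1) = 2^{n−3}(n−2)(n−4)`, the same for every window `k` (the second type
count of the planted square `4X(X−1)(2X−1)^{n−4}`). [cite: MadrasSlade1993, §1.1 (p. 3); §1.1 eq. (1.1.8) p. 5; lane theorem] -/
theorem card_sqSet {l k : ℕ} (hn : n = l + 3) (hk : k + 4 ≤ n) : ((sqSet n l k).card : ℚ) = 2 ^ l * ((l : ℚ) ^ 2 - 1) := by
  have H := (card_canonical_atWindow_isPat (n := n) sqPat_good (by norm_num) hk).2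
  rw [card_free_sqPat] at H
  rw [sqSet, filter_slice_eq _ (show l = 2 + (n - 4) - 1 by omega), H, show 2 + (n - 4) = l + 1 by omega,
    show ((n - 4 : ℕ) : ℚ) = (l : ℚ) - 1 by rw [show n - 4 = l - 1 by omega, Nat.cast_sub (by omega), Nat.cast_one],
    show (Nat.choose 2 2 : ℚ) = 1 by norm_num]
  have h2 := two_mul_choose_two_cast (l + 1)
  push_cast at h2 ⊢
  rw [pow_succ]
  linear_combination (2 : ℚ) ^ l * h2

/-- ★ THE DOUBLE-SQUARE CLASS AT A FIXED WINDOW: `2^l` (top type count of `4X(X−1)(2X−1)^{n−5}`; loop signature `(4,4)`).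
[cite: MadrasSlade1993, §1.1 (p. 3); lane theorem] -/
theorem card_dsqSet {l k : ℕ} (hn : n = l + 3) (hk : k + 5 ≤ n) : (dsqSet n l k).card = 2 ^ l := by
  have H := (card_canonical_atWindow_isPat (n := n) dsqPat_good (by norm_num) hk).1
  rw [card_free_dsqPat] at H
  rw [dsqSet, filter_slice_eq _ (show l = 2 + (n - 5) by omega), H, show 2 + (n - 5) = l by omega]

/-- ★ EACH HEXAGON CLASS AT A FIXED WINDOW: `2^l` (top type count of `8X(X−1)(X−2)(2X−1)^{n−6}`).
[cite: MadrasSlade1993, §1.2 (p. 10); lane theorem] -/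
theorem card_hexSet {l k : ℕ} (hn : n = l + 3) (hk : k + 6 ≤ n) (i : Fin 5) : (hexSet n l k i).card = 2 ^ l := by
  have H := (card_canonical_atWindow_isPat (n := n) (hexPat_good i) (by norm_num) hk).1
  rw [card_free_hexPat] at H
  rw [hexSet, filter_slice_eq _ (show l = 3 + (n - 6) by omega), H, show 3 + (n - 6) = l by omega]

/-! ### Assembly: the path inclusion–exclusion over the square windows, plus the pure hexagons -/

/-- The pure hexagons as a disjoint union over (window, pattern). [cite: MadrasSlade1993, §1.2 (p. 10); lane lemma] -/
theorem hexUnion_eq_biUnion {l : ℕ} :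
    hexUnion n l = ((Finset.range (n - 5)) ×ˢ (Finset.univ.filter fun i : Fin 5 => i ≠ 4)).biUnion
      fun x => hexSet n l x.1 x.2 := by
  classical
  ext τ
  simp only [hexUnion, hexSet, Finset.mem_filter, Finset.mem_biUnion, Finset.mem_product, Finset.mem_range, Finset.mem_univ,
    true_and, Prod.exists]
  constructor
  · rintro ⟨hτ, k, i, hi, h⟩
    exact ⟨k, i, ⟨by have := h.1; omega, hi⟩, hτ, h⟩
  · rintro ⟨k, i, ⟨-, hi⟩, hτ, h⟩
    exact ⟨hτ, k, i, hi, h⟩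

/-- ★ THE PURE HEXAGONS NUMBER `4(n−5)·2^l`. [cite: MadrasSlade1993, §1.2 (p. 10); lane lemma] -/
theorem card_hexUnion {l : ℕ} (hn : n = l + 3) : (hexUnion n l).card = (n - 5) * 4 * 2 ^ l := by
  classical
  rw [hexUnion_eq_biUnion, Finset.card_biUnion]
  · rw [Finset.sum_congr rfl fun x hx => card_hexSet hn (by have := (Finset.mem_product.1 hx).1; rw [Finset.mem_range] at this; omega) x.2,
      Finset.sum_const, smul_eq_mul, Finset.card_product, Finset.card_range]
    rw [show (Finset.univ.filter fun i : Fin 5 => i ≠ 4).card = 4 by decide]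
  · intro x hx y hy hxy
    refine Finset.disjoint_left.2 fun τ h1 h2 => hxy ?_
    have hτ : τ ∈ slice n l := (Finset.mem_filter.1 h1).1
    have g1 : AtWindow (IsPat (hexPat x.2)) x.1 τ := (Finset.mem_filter.1 h1).2
    have g2 : AtWindow (IsPat (hexPat y.2)) y.1 τ := (Finset.mem_filter.1 h2).2
    have hx4 : x.2 ≠ 4 := (Finset.mem_filter.1 (Finset.mem_product.1 (Finset.mem_coe.1 hx)).2).2
    have hy4 : y.2 ≠ 4 := (Finset.mem_filter.1 (Finset.mem_product.1 (Finset.mem_coe.1 hy)).2).2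
    rcases lt_trichotomy x.1 y.1 with hlt | heq | hgt
    · exact (hex_hex_lt hτ hn hlt g1 g2).elim
    · by_cases hi : x.2 = y.2
      · exact Prod.ext heq hi
      · rw [heq] at g1
        exact (hex_hex_same hi hx4 hy4 g1 g2).elim
    · exact (hex_hex_lt hτ hn hgt g2 g1).elim

/-- No window, no square. [cite: MadrasSlade1993, §1.1 (p. 3); lane plumbing] -/
theorem sqUnion_zero {l : ℕ} : sqUnion n l 0 = ∅ := by
  classical
  unfold sqUnion
  exact Finset.filter_false_of_mem fun τ _ ⟨k, hk, _⟩ => absurd hk (by omega)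

/-- One more window. [cite: MadrasSlade1993, §1.1 (p. 3); lane plumbing] -/
theorem sqUnion_succ {l : ℕ} (K : ℕ) : sqUnion n l (K + 1) = sqUnion n l K ∪ sqSet n l K := by
  classical
  ext τ
  simp only [sqUnion, sqSet, Finset.mem_union, Finset.mem_filter]
  constructor
  · rintro ⟨hτ, k, hk, h⟩
    by_cases hkK : k = K
    · subst hkK; exact Or.inr ⟨hτ, h⟩
    · exact Or.inl ⟨hτ, k, by omega, h⟩
  · rintro (⟨hτ, k, hk, h⟩ | ⟨hτ, h⟩)
    · exact ⟨hτ, k, by omega, h⟩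
    · exact ⟨hτ, K, by omega, h⟩

/-- ★ THE ONLY OVERLAP of the new window with the earlier ones is the double square at the previous window.
[cite: MadrasSlade1993, §1.1 (p. 3); lane lemma] -/
theorem sqUnion_inter_sqSet {l : ℕ} (hn : n = l + 3) (K : ℕ) :
    sqUnion n l (K + 1) ∩ sqSet n l (K + 1) = dsqSet n l K := by
  classical
  ext τ
  simp only [sqUnion, sqSet, dsqSet, Finset.mem_inter, Finset.mem_filter]
  constructor
  · rintro ⟨⟨hτ, k, hk, h1⟩, -, h2⟩
    by_cases hkK : k = K
    · subst hkK; exact ⟨hτ, sq_and_sq_succ_iff_dsq.1 ⟨h1, h2⟩⟩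
    · exact (sq_sq_far hτ hn (show k + 2 ≤ K + 1 by omega) h1 h2).elim
  · rintro ⟨hτ, h⟩
    obtain ⟨h1, h2⟩ := sq_and_sq_succ_iff_dsq.2 h
    exact ⟨⟨hτ, K, by omega, h1⟩, hτ, h2⟩

/-- ★★ THE SQUARES NUMBER `K·2^l(l² − 1) − (K−1)·2^l` over the first `K ≥ 1` windows (path inclusion–exclusion).
[cite: MadrasSlade1993, §1.1 (p. 3); §1.1 eq. (1.1.8) p. 5; lane theorem] -/
theorem card_sqUnion {l : ℕ} (hn : n = l + 3) (K : ℕ) (hK : K + 4 ≤ n) :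
    ((sqUnion n l (K + 1)).card : ℚ) = ((K : ℚ) + 1) * (2 ^ l * ((l : ℚ) ^ 2 - 1)) - (K : ℚ) * 2 ^ l := by
  classical
  induction K with
  | zero =>
    rw [sqUnion_succ, sqUnion_zero, Finset.empty_union, card_sqSet hn (by omega)]
    push_cast; ring
  | succ K ih =>
    have hcard := Finset.card_union_add_card_inter (sqUnion n l (K + 1)) (sqSet n l (K + 1))
    rw [← sqUnion_succ, sqUnion_inter_sqSet hn, card_dsqSet hn (by omega)] at hcard
    have hq : ((sqUnion n l (K + 1 + 1)).card : ℚ) + 2 ^ l = (sqUnion n l (K + 1)).card + (sqSet n l (K + 1)).card := by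
      exact_mod_cast hcard
    rw [ih (by omega), card_sqSet hn (by omega)] at hq
    push_cast
    linear_combination hq

/-- ★★★ THE CENSUS LAW (L1) AS A COUNT: the bad words of the slice number `2^l(l³ + 2l − 7) = 2^{n−3}(n³ − 9n² + 29n − 40)` (`n = l+3 ≥ 5`).
[cite: MadrasSlade1993, §1.1 eq. (1.1.8) p. 5; lane theorem] -/
theorem card_badSet (l : ℕ) (hl : 2 ≤ l) : ((badSet (l + 3) l).card : ℚ) = 2 ^ l * ((l : ℚ) ^ 3 + 2 * l - 7) := by
  classical
  obtain ⟨K, hK⟩ : ∃ K, l = K + 1 := ⟨l - 1, by omega⟩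
  rw [badSet_eq_union rfl, Finset.card_union_of_disjoint (disjoint_sqUnion_hexUnion rfl _), Nat.cast_add,
    show l + 3 - 3 = K + 1 by omega, card_sqUnion rfl K (by omega), card_hexUnion rfl,
    show l + 3 - 5 = l - 2 by omega]
  push_cast [Nat.cast_sub hl]
  rw [hK]
  push_cast
  ring

open Classical in
/-- ★★★ THE CENSUS LAW (L1) — THE CANONICAL-WORD COUNT: the canonical reversal-free words of length `n = l + 3 ≥ 5` with `l` axes and a
repeat number `2^l·(n³ − 9n² + 29n − 40)`; exactly the hypothesis `hT` of `SAWCountZdBadWordTypes.exists_polynomial_count_topFour_of_card_canonical`.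
[cite: MadrasSlade1993, §1.1 eq. (1.1.8) p. 5; §1.2 (p. 10); lane theorem] -/
theorem card_badCanonical (l : ℕ) (hl : 2 ≤ l) :
    ((Finset.univ.filter fun τ : Word (l + 3) (l + 3) => canon τ = τ ∧ numAxes τ = l ∧
        (∀ p : Fin (l + 3), ∀ hp : p.val + 1 < l + 3, τ ⟨p.val + 1, hp⟩ ≠ ((τ p).1, !(τ p).2)) ∧
        (∃ i ≤ l + 3, ∃ j ≤ l + 3, i < j ∧ wordPos τ i = wordPos τ j)).card : ℚ) =
      2 ^ l * (((l : ℚ) + 3) ^ 3 - 9 * ((l : ℚ) + 3) ^ 2 + 29 * ((l : ℚ) + 3) - 40) := by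
  have hset : (Finset.univ.filter fun τ : Word (l + 3) (l + 3) => canon τ = τ ∧ numAxes τ = l ∧
        (∀ p : Fin (l + 3), ∀ hp : p.val + 1 < l + 3, τ ⟨p.val + 1, hp⟩ ≠ ((τ p).1, !(τ p).2)) ∧
        (∃ i ≤ l + 3, ∃ j ≤ l + 3, i < j ∧ wordPos τ i = wordPos τ j)) = badSet (l + 3) l := by
    ext τ
    simp only [badSet, slice, NoRev, Finset.mem_filter, Finset.mem_univ, true_and]
    constructor
    · rintro ⟨a, b, c, d⟩; exact ⟨⟨a, c, b⟩, d⟩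
    · rintro ⟨⟨a, c, b⟩, d⟩; exact ⟨a, b, c, d⟩
  rw [hset, card_badSet l hl]
  ring

end CensusL1

end WordTypes

section Assembly

open WordTypes

/-- ★★★ THE FOURTH COEFFICIENT OF `c_n(ℤ^d)`, UNCONDITIONALLY: for `n = l + 3 ≥ 5` there is `P ∈ ℚ[X]` with `c_n(ℤ^d) = P(d)` for every `d`,
`deg P ≤ n`, `[X^n]P = 2^n`, `[X^{n−1}]P = −(n−1)2^{n−1}`, `[X^{n−2}]P = 2^{n−3}(n²−5n+8)` and
`48·[X^{n−3}]P = −2^n(n³ − 12n² + 59n − 138)` — the census law (L1). [cite: MadrasSlade1993, §1.1 eq. (1.1.8) p. 5; lane theorem] -/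
theorem exists_polynomial_count_topFour (l : ℕ) (hl : 2 ≤ l) :
    ∃ P : Polynomial ℚ, P.natDegree ≤ l + 3 ∧ P.coeff (l + 3) = (2 : ℚ) ^ (l + 3) ∧
      P.coeff (l + 2) = -(((l + 3 : ℕ) : ℚ) - 1) * 2 ^ (l + 2) ∧
      P.coeff (l + 1) = 2 ^ l * (((l + 3 : ℕ) : ℚ) ^ 2 - 5 * ((l + 3 : ℕ) : ℚ) + 8) ∧
      48 * P.coeff l = -(2 : ℚ) ^ (l + 3) * (((l + 3 : ℕ) : ℚ) ^ 3 - 12 * ((l + 3 : ℕ) : ℚ) ^ 2 + 59 * ((l + 3 : ℕ) : ℚ) - 138) ∧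
      ∀ d : ℕ, (count d (l + 3) : ℚ) = P.eval (d : ℚ) :=
  exists_polynomial_count_topFour_of_card_canonical l (card_badCanonical l hl)

/-- ★★★ Am. BC's FOURTH-SYMBOL LAW FROM THE SPAN-TWO BRIDGE COUNT ALONE: with (L1) proved, the law
`[d^{k−3}] c_k^{(d)} = (−1)^{k−1}2^{k−3}(k−3)(k−4)(5k²−35k+56)/12` (`k ≥ 3`) follows from the single remaining census count, the second axis
class of the span-two cell. [cite: MadrasSlade1993, §1.1 eq. (1.1.8) p. 5; §4.2 eq. (4.2.20)–(4.2.22)] [cite: ClisbyLiangSlade2007, §1.3 eq. (1)/(3); lane theorem] -/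
theorem exists_polynomial_largeForceCoeffZd_thirdCoeff_of_bridge_count
    (hF : ∀ m : ℕ, 1 ≤ m → (((irreducibleBridges (m + 1) (m + 5)).filter fun (ω : ℕ → Site (m + 1)) => costZd m (m + 5) ω = m + 3 ∧
        ∀ a : Fin (m + 1), a ≠ 0 → ∃ i ≤ m + 5, ω i a ≠ (0 : ℤ)).card : ℚ) =
      (m.factorial : ℚ) * 2 ^ m * ((((m : ℚ) + 3) ^ 5 - 12 * ((m : ℚ) + 3) ^ 4 + 59 * ((m : ℚ) + 3) ^ 3 - 162 * ((m : ℚ) + 3) ^ 2 +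
        276 * ((m : ℚ) + 3) - 234) / 6))
    {k : ℕ} (hk : 3 ≤ k) :
    ∃ P : Polynomial ℚ, P.natDegree = k - 1 ∧ P.leadingCoeff = (-2 : ℚ) ^ (k - 1) ∧
      P.coeff (k - 2) = (-1 : ℚ) ^ (k - 1) * 2 ^ (k - 2) * ((k : ℚ) ^ 2 - 5 * k + 7) ∧
      P.coeff (k - 3) = (-1 : ℚ) ^ (k - 1) * 2 ^ (k - 3) * (((k : ℚ) - 3) * ((k : ℚ) - 4) * (5 * (k : ℚ) ^ 2 - 35 * (k : ℚ) + 56)) / 12 ∧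
      ∀ d : ℕ, (largeForceCoeffZd d k : ℚ) = P.eval (d : ℚ) :=
  exists_polynomial_largeForceCoeffZd_thirdCoeff_of_word_and_bridge_counts (fun l hl => card_badCanonical l hl) hF hk

end Assembly

end Literature.Probability.RandomPlanarGeometry.SAW.Zd

end
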